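import Mathlib
import HarnessLib
import Summits.HubbardSuperconductivity.HubbardSuperconductivity.Theorems.KLProgrammeKLRegimeEngineTowerWtStepLinkUniform
import Summits.HubbardSuperconductivity.HubbardSuperconductivity.Theorems.KLProgrammeKLRegimeEngineTowerLevStepLinkUniformFKlEng

/-!
# Route `KLProgramme` — crux K3 ENGINE (stmt-HubbardSuperconductivity-20437 `KLRegimeEngineV17F2`), stub (b) v2, THE WEIGHTED HALF «(b)-WT4»:
# W2b — THE k-UNIFORM WEIGHTED LINK ON THE FLOW FRAME `K_n`, LINK DATA DISCHARGED FROM THE MODEL, TOKENISED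
# (cell gate-hubbard-kl, seat hubbard-kl-k3c3-p2 g17; weighted twin of …TowerLevStepLinkUniformFKlEng (k3c2-p3 g14) over W2 `wtLaw_hstep_of_blockBounds`;
#  E1 may rename or supersede)

`wtLaw_hstep_of_blockBounds` (…TowerWtStepLinkUniform, W2) delivers the `hstep` binder of W1's weighted law from four k-free bounds on the block data: the Gram
constant `κ_k²·8^{dk} ≤ κ̄²`, the WEIGHTED decay constant `α_k ≤ ᾱ·4^{dk}` and the WEIGHTED analysis-overlap rows/cols `≤ c̄r, c̄c`, every weight at the run's
rate `j`.  On the flow frame `K := klFlowFrameU … n` the three model packages (p3's `gram_sliceCT_bgmFat_sharp_klEng`, this lineage's window-free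
`alphaWt_towerBlock_klEng_flow_all'` (g12, J-α) and `overlapWt_towerBlock_klEng_flow_all` (g12, W5) — both stated at EVERY rate `j ≥ dk`) give, for every block `k`,
`κ_k = √(Cκ·(Λ_{dk}/Λ_{dk−1})·e₀·8^{−(dk−1)})` (so `κ_k²·8^{dk} = 2Cκe₀`, `gramF_sq_mul_pow_eq`), `α_k = Cb·(M/β)/Λ_{d(k+1)} = (Cb·(M/β)·4^d/e₀)·4^{dk}`
(`alphaF_eq_bound_mul_pow`), `c̄r = 81·CJ·M/β`, `c̄c = 162·CJ·M/β` — the SAME constants as the levelled «(ℓ)-LINK-F-KLENG», the weights KEPT: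
* §1 **`wtLaw_hstep_klEng_tok (d R c″)`** — `∃ Cκ Cb CJ > 0`: under the v1 doors, an admissible history at scale `n`, `2 ≤ d`, every block count `Kb` with
  `d·Kb ≤ n_β+1`, `d·Kb ≤ n + d` and every rate `j` with `d·Kb ≤ j + d` (so `dk ≤ j` at every block `k < Kb`), a degree cap `D`: with `κ̄ ᾱ c̄r c̄c` and then
  `W Z σ τ ψ Φ` pinned by equations (`W = 32c̄r/c̄c`, `Z = ε²c̄c²/8`, `σ = κ̄²/c̄c²`, `τ = 4e⁴κ̄²/c̄c²`, `ψ = c̄c²/κ̄²`, `Φ = e·ᾱ·c̄c/(κ̄²·c̄r)`), the `hstep` binder of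
  `klTowerBornWtAt_le_law_of_inputs_base_tokX` holds at `K_n` with the per-block premise `Z^{K_n}_{Λ_{dk}} ≠ 0` INSIDE (Z-thread shape);
* §2 **`linkDataW_klEng (d R c″)`** — the per-block WEIGHTED LINK data as one bundle at every rate `j ≥ dk` (Gram constant positive / k-free form / `IsGramBoundedR`;
  weighted rows, cols `≤ α_k`, `α_k ≤ ᾱ·4^{dk}`; weighted analysis-overlap rows/cols `≤ c̄r, c̄c`) — the inputs of the Z-step (W4) and of the block discharge (W5).
Compositions of landed theorems; nothing about the model is asserted beyond them; nothing asserts (b), (ℓ), any stub, K3 or superconductivity.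
References: BGM 2006 §2.7 (2.71a), §2.8 (2.76)–(2.84), §3 (3.2)–(3.8) [cite: BenfattoGiulianiMastropietro2006].
-/

noncomputable section

namespace Summit.HubbardSuperconductivity.HubbardSuperconductivity.Theorems.EngineV8

set_option linter.dupNamespace false -- summit = problem name (single-conjunct summit), D-0017

open Classical
open Real Finset Literature.MathematicalPhysics.QuantumLattice Literature.Probability.LatticeModels GrassmannAlgebra
open Literature.MathematicalPhysics.QuantumLattice.FermiRG Literature.MathematicalPhysics.QuantumLattice.FermiRG.BGM2006Routing
open Summit.HubbardSuperconductivity.HubbardSuperconductivity.Theorems.KLProgrammeLegKernels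
open Summit.HubbardSuperconductivity.HubbardSuperconductivity.Theorems.KLRegimeSplit
open Summit.HubbardSuperconductivity.HubbardSuperconductivity.Theorems.KLRegimeWick
open Summit.HubbardSuperconductivity.HubbardSuperconductivity.Theorems.TwoPointAssembly
open Summit.HubbardSuperconductivity.HubbardSuperconductivity.Theorems.DispersionFlow
open Summit.HubbardSuperconductivity.HubbardSuperconductivity.Theorems.TorusFourierL2

variable {L M : ℕ} [NeZero L] [NeZero M]

/-! ## §1 The weighted `hstep` binder on the flow frame, LINK data from the model, tokenised -/

/-- **THE k-UNIFORM WEIGHTED LINK ON THE FLOW FRAME, LINK DATA DISCHARGED, TOKENISED**: `∃ Cκ Cb CJ > 0` such that, under the v1 doors, an admissible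
history at scale `n` (`HistP … 0 n`, `FrameOK … K_n`, `IsKLRegime U c (−n)`, the (K5′) clauses, `c″U ≤ 1`), `2 ≤ d`, every block count `Kb` with
`d·Kb ≤ n_β + 1`, `d·Kb ≤ n + d`, every rate `j` with `d·Kb ≤ j + d` and a degree cap `D ≥ card/2` at every block: with `κ̄ ᾱ c̄r c̄c` and then `W Z σ τ ψ Φ`
pinned by equations to the model expressions of the module docstring, the `hstep` binder of `klTowerBornWtAt_le_law_of_inputs_base_tokX` holds at
`K := klFlowFrameU … n`, the per-block partition-function premise inside. [cite: BenfattoGiulianiMastropietro2006, §2.8 (2.76)-(2.84), §3 (3.2)-(3.8)] -/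
theorem wtLaw_hstep_klEng_tok (d : ℕ) (R : RenConsts) (c'' : ℝ) (hc'' : 0 < c'') :
    ∃ Cκ Cb CJ : ℝ, 0 < Cκ ∧ 0 < Cb ∧ 0 < CJ ∧
      ∀ (G : GeoConsts) (P : SplitConsts) (Q : EngConsts) (c : ℝ), P.WF → R.WF2 → 0 < c → c ≤ klEngC₃6 P R →
      ∀ μ ∈ klWindowC, ∀ U : ℝ, 0 < U → U ≤ klEngU₀9 P R c → c'' * U ≤ 1 →
      ∀ β : ℝ, klBetaMin ≤ β → β ≤ Real.exp (c / U ^ 2) →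
      ∀ (L M : ℕ) [NeZero L] [NeZero M], klEngL₃ β U ≤ L → klEngM₃ β U L ≤ M →
      ∀ n : ℕ, 1 ≤ n → n ≤ nScales β + 1 → IsKLRegime U c (-(n : ℤ)) →
        HistP klPredsV17F2 L M G P Q R β U μ 0 n → FrameOK R U (nScales β) μ (klFlowFrameU L M β U μ n) →
        (∀ m, 1 ≤ m → m < n → FlowPieceOscAt L M c'' β U μ m) →
      2 ≤ d → ∀ Kb : ℕ, d * Kb ≤ nScales β + 1 → d * Kb ≤ n + d → ∀ j : ℕ, d * Kb ≤ j + d →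
      ∀ D : ℕ, (∀ k, 1 ≤ k → k < Kb → Fintype.card (SpaceTimeIdx L M × SectorLeg (sectorCount (d * k - 1))) / 2 ≤ D) →
      ∀ (κb αb crb ccb : ℝ), κb = Real.sqrt (2 * Cκ * klE0) → αb = Cb * ((M : ℝ) / β) * (4 : ℝ) ^ d / klE0 →
        crb = 81 * CJ * M / β → ccb = 162 * CJ * M / β →
      ∀ (W Z σ τ ψ Φ : ℝ),
        W = 32 * crb / ccb → Z = imagTimeWeight β M ^ 2 * ccb ^ 2 / 8 →
        σ = κb ^ 2 / ccb ^ 2 → τ = 4 * exp 4 * κb ^ 2 / ccb ^ 2 → ψ = ccb ^ 2 / κb ^ 2 → Φ = exp 1 * αb * ccb / (κb ^ 2 * crb) →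
      ∀ k, 1 ≤ k → k < Kb →
        hubbardEffPartitionFnCT L M β U μ 0 (klFlowFrameU L M β U μ n) (klScale klE0 (d * k)) ≠ 0 → ∀ N : ℕ, 2 ≤ N → ∀ p, 3 ≤ p → p ≤ D →
        Φ * towerV D τ (fun m => W * Z ^ m *
          (klTowerMeasWtAt L M β U μ (klFlowFrameU L M β U μ n) d k j (2 * m) / klLevUnitF β M 0 m (d * k - 1))) < 1 →
        klTowerBornWtAt L M β U μ (klFlowFrameU L M β U μ n) d k j (2 * p) / klLevUnitF β M 0 p (d * k) ≤
          towerFO D σ (fun m => W * Z ^ m *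
              (klTowerMeasWtAt L M β U μ (klFlowFrameU L M β U μ n) d k j (2 * m) / klLevUnitF β M 0 m (d * k - 1))) p +
            ∑ n' ∈ Icc 2 N, exp 1 * Φ ^ (n' - 1) * ψ ^ p *
              towerS D τ (fun m => W * Z ^ m *
                (klTowerMeasWtAt L M β U μ (klFlowFrameU L M β U μ n) d k j (2 * m) / klLevUnitF β M 0 m (d * k - 1))) n' p +
            ψ ^ p * exp 1 * towerV D τ (fun m => W * Z ^ m *
                (klTowerMeasWtAt L M β U μ (klFlowFrameU L M β U μ n) d k j (2 * m) / klLevUnitF β M 0 m (d * k - 1))) *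
              (Φ * towerV D τ (fun m => W * Z ^ m *
                (klTowerMeasWtAt L M β U μ (klFlowFrameU L M β U μ n) d k j (2 * m) / klLevUnitF β M 0 m (d * k - 1)))) ^ N /
              (1 - Φ * towerV D τ (fun m => W * Z ^ m *
                (klTowerMeasWtAt L M β U μ (klFlowFrameU L M β U μ n) d k j (2 * m) / klLevUnitF β M 0 m (d * k - 1)))) := by
  obtain ⟨Cκ, hCκ, hg⟩ := gram_sliceCT_bgmFat_sharp_klEng
  obtain ⟨Cb, hCb, hαp⟩ := alphaWt_towerBlock_klEng_flow_all' d R c'' hc''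
  obtain ⟨CJ, hCJ, hop⟩ := overlapWt_towerBlock_klEng_flow_all d R c'' hc''.le
  refine ⟨Cκ, Cb, CJ, hCκ, hCb, hCJ, ?_⟩
  intro G P Q c hP hR2 hc hc6 μ hμ U hU hU9 hcU β hβmin hβc L M _ _ hL3 hM3 n hn1 hnN hreg hhist hfr hosc hd Kb hKbN hKbn j hKbj D hD
    κb αb crb ccb hκb hαb hcrb hccb W Z σ τ ψ Φ hW hZ' hσ hτ hψ hΦ
  have he : (0 : ℝ) < klE0 := by norm_num [klE0]
  have hβ : 0 < β := KLRegimeSplit.pos_of_klBetaMin_le hβmin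
  have hM0 : (0 : ℝ) < M := Nat.cast_pos.2 (Nat.pos_of_ne_zero (NeZero.ne M))
  -- doors of the three packages below the v1 binder `U ≤ klEngU₀9`
  have hU4 : U ≤ klEngU₀4 P R c := hU9.trans (klEngU₀9_le_klEngU₀4 P R c)
  have hU3g : U ≤ min (klEngU₀3 P R c) (1 / (R.Gfr 3 + 1)) :=
    le_min (hU9.trans (klEngU₀9_le_klEngU₀3 P R c)) (hU9.trans (klEngU₀9_le_inv_gfr_add_one P hR2.wf c (by norm_num)))
  have hc3 : c ≤ klEngC₃3 P R := hc6.trans (klEngC₃6_le_klEngC₃3 P R)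
  set K : TrigPolyC4v := klFlowFrameU L M β U μ n with hKdef
  -- the four k-free constants are positive
  have hκb0 : 0 < κb := by rw [hκb]; exact Real.sqrt_pos.2 (by positivity)
  have hαb0 : 0 < αb := by rw [hαb]; positivity
  have hcrb0 : 0 < crb := by rw [hcrb]; positivity
  have hccb0 : 0 < ccb := by rw [hccb]; positivity
  -- the per-block data
  have hblk : ∀ k, 1 ≤ k → k < Kb → 2 ≤ d * k ∧ d * (k + 1) ≤ nScales β + 1 ∧ d * k ≤ n ∧ d * k ≤ j := by
    intro k hk1 hk
    refine ⟨le_trans hd (Nat.le_mul_of_pos_right d hk1), le_trans (Nat.mul_le_mul_left d (by omega)) hKbN, ?_, ?_⟩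
    · have h1 : d * k + d ≤ d * Kb := by rw [← Nat.mul_succ]; exact Nat.mul_le_mul_left d (by omega)
      omega
    · have h1 : d * k + d ≤ d * Kb := by rw [← Nat.mul_succ]; exact Nat.mul_le_mul_left d (by omega)
      omega
  refine wtLaw_hstep_of_blockBounds (L := L) (M := M) hβ U μ K (by omega) j Kb hκb0 hαb0 hcrb0 hccb0
    (fun k => Real.sqrt (Cκ * (klScale klE0 (d * k) / klScale klE0 (d * k - 1)) * (klE0 * ((8 : ℝ) ^ (d * k - 1))⁻¹)))
    (fun k => Cb * ((M : ℝ) / β) / klScale klE0 (d * (k + 1)))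
    (fun k hk1 hk => ?_) (fun k hk1 hk => ?_) (fun k hk1 hk => ?_) (fun k hk1 hk => ?_) (fun k hk1 hk => ?_) (fun k hk1 hk => ?_)
    (fun k hk1 hk => ?_) (fun k hk1 hk => ?_) hD W Z σ τ ψ Φ hW hZ' hσ hτ hψ hΦ
  · -- `0 < κ_k`
    have h1 : 0 < klScale klE0 (d * k) := klth_klScale_pos _
    have h2 : 0 < klScale klE0 (d * k - 1) := klth_klScale_pos _
    exact Real.sqrt_pos.2 (by positivity)
  · -- `κ_k²·8^{dk} ≤ κ̄²`
    obtain ⟨hdk, -, -, -⟩ := hblk k hk1 hk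
    rw [hκb, gramF_sq_mul_pow_eq hCκ.le (by omega)]
  · -- `α_k ≤ ᾱ·4^{dk}`
    rw [hαb, alphaF_eq_bound_mul_pow]
  · -- Gram of the fat-sandwiched slice
    obtain ⟨hdk, hkN, -, -⟩ := hblk k hk1 hk
    have hΛpos : 0 < klScale klE0 (d * (k + 1)) := klth_klScale_pos _
    have hΛle : klScale klE0 (d * (k + 1)) ≤ klScale klE0 (d * k) := klScale_le_klScale he.le (Nat.mul_le_mul_left d (Nat.le_succ k))
    have hΛle' : klScale klE0 (d * k) ≤ klScale klE0 (d * k - 1) := klScale_le_klScale he.le (by omega)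
    obtain ⟨m, hm⟩ : ∃ m, d * k - 1 = m + 1 := ⟨d * k - 2, by omega⟩
    have hmul : d * (k + 1) = d * k + d := Nat.mul_succ d k
    have h := (hg P R c hP hR2 hc hc3 μ hμ U hU hU4 β hβmin hβc K hfr L M hL3 hM3 m (by omega)
      (klScale klE0 (d * (k + 1))) (klScale klE0 (d * k)) hΛpos hΛle (by rw [← hm]; exact hΛle')).2.1
    rw [← hm] at h
    exact h
  · -- weighted rows at rate `j`
    obtain ⟨hdk, hkN, -, hkj⟩ := hblk k hk1 hk
    exact (hαp G P Q c hR2 hc hc6 μ hμ U hU hU3g hcU β hβmin hβc L M hL3 hM3 n hn1 hnN hreg hhist hosc k hk1 hdk hkN j hkj).1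
  · -- weighted columns at rate `j`
    obtain ⟨hdk, hkN, -, hkj⟩ := hblk k hk1 hk
    exact (hαp G P Q c hR2 hc hc6 μ hμ U hU hU3g hcU β hβmin hβc L M hL3 hM3 n hn1 hnN hreg hhist hosc k hk1 hdk hkN j hkj).2
  · -- weighted analysis-overlap rows at rate `j`
    obtain ⟨hdk, -, hkn, hkj⟩ := hblk k hk1 hk
    rw [hcrb]
    exact (hop G P Q c hR2 hc hc6 μ hμ U hU hU3g hcU β hβmin hβc L M hL3 hM3 n hn1 hnN hreg hhist hosc k (by omega) hkn j hkj).1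
  · -- weighted analysis-overlap columns at rate `j`
    obtain ⟨hdk, -, hkn, hkj⟩ := hblk k hk1 hk
    obtain ⟨-, hcol'⟩ := hop G P Q c hR2 hc hc6 μ hμ U hU hU3g hcU β hβmin hβc L M hL3 hM3 n hn1 hnN hreg hhist hosc k (by omega) hkn j hkj
    have h2 : (2 : ℝ) ^ (d * k - (d * k - 1)) = 2 := by rw [show d * k - (d * k - 1) = 1 by omega, pow_one]
    rw [hccb]
    intro X'
    have h := hcol' X'
    rw [h2] at h
    exact h.trans (le_of_eq (by ring))

/-! ## §2 The per-block WEIGHTED LINK data as a bundle (for the Z-step W4 and the block discharge W5) -/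

/-- **THE WEIGHTED LINK's PER-BLOCK DATA ON THE FLOW FRAME, FROM THE MODEL, AS ONE BUNDLE** — for every block `k ≥ 1` with `2 ≤ dk`, `d(k+1) ≤ n_β+1`,
`dk ≤ n` and every rate `j ≥ dk`: the Gram constant `κ_k = √(Cκ·(Λ_{dk}/Λ_{dk−1})·e₀·8^{−(dk−1)})` of the fat-sandwiched slice (positive, k-free form
`κ_k²·8^{dk} ≤ (√(2Cκe₀))²`, `IsGramBoundedR`), the rate-`j` WEIGHTED rows/cols `≤ α_k = Cb·(M/β)/Λ_{d(k+1)} ≤ (Cb·(M/β)·4^d/e₀)·4^{dk}`, and the rate-`j` WEIGHTED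
analysis-overlap rows/cols `≤ 81·CJ·M/β`, `≤ 162·CJ·M/β` — the eight per-block hypotheses of `wtLaw_hstep_of_blockBounds` (W2), under the v1 doors and an admissible
history at scale `n`. [cite: BenfattoGiulianiMastropietro2006, §2.7 (2.71a), §2.8 (2.77), (2.81)-(2.83)] -/
theorem linkDataW_klEng (d : ℕ) (R : RenConsts) (c'' : ℝ) (hc'' : 0 < c'') :
    ∃ Cκ Cb CJ : ℝ, 0 < Cκ ∧ 0 < Cb ∧ 0 < CJ ∧
      ∀ (G : GeoConsts) (P : SplitConsts) (Q : EngConsts) (c : ℝ), P.WF → R.WF2 → 0 < c → c ≤ klEngC₃6 P R →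
      ∀ μ ∈ klWindowC, ∀ U : ℝ, 0 < U → U ≤ klEngU₀9 P R c → c'' * U ≤ 1 →
      ∀ β : ℝ, klBetaMin ≤ β → β ≤ Real.exp (c / U ^ 2) →
      ∀ (L M : ℕ) [NeZero L] [NeZero M], klEngL₃ β U ≤ L → klEngM₃ β U L ≤ M →
      ∀ n : ℕ, 1 ≤ n → n ≤ nScales β + 1 → IsKLRegime U c (-(n : ℤ)) →
        HistP klPredsV17F2 L M G P Q R β U μ 0 n → FrameOK R U (nScales β) μ (klFlowFrameU L M β U μ n) →
        (∀ m, 1 ≤ m → m < n → FlowPieceOscAt L M c'' β U μ m) →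
      ∀ k : ℕ, 1 ≤ k → 2 ≤ d * k → d * (k + 1) ≤ nScales β + 1 → d * k ≤ n → ∀ j : ℕ, d * k ≤ j →
        0 < Real.sqrt (Cκ * (klScale klE0 (d * k) / klScale klE0 (d * k - 1)) * (klE0 * ((8 : ℝ) ^ (d * k - 1))⁻¹)) ∧
        Real.sqrt (Cκ * (klScale klE0 (d * k) / klScale klE0 (d * k - 1)) * (klE0 * ((8 : ℝ) ^ (d * k - 1))⁻¹)) ^ 2 * (8 : ℝ) ^ (d * k) ≤ Real.sqrt (2 * Cκ * klE0) ^ 2 ∧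
        IsGramBoundedR ((sectorSubMatrix L M β (bgmFatMultiplier L M klE0 β (nambuXiCT L μ (klFlowFrameU L M β U μ n)) (d * k - 1))).transpose * hubbardCovSliceCT L M β μ 0 (klFlowFrameU L M β U μ n) (klScale klE0 (d * (k + 1))) (klScale klE0 (d * k)) * sectorSubMatrix L M β (bgmFatMultiplier L M klE0 β (nambuXiCT L μ (klFlowFrameU L M β U μ n)) (d * k - 1))) (Real.sqrt (Cκ * (klScale klE0 (d * k) / klScale klE0 (d * k - 1)) * (klE0 * ((8 : ℝ) ^ (d * k - 1))⁻¹))) ∧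
        (∀ X, ∑ Y, ‖((sectorSubMatrix L M β (bgmFatMultiplier L M klE0 β (nambuXiCT L μ (klFlowFrameU L M β U μ n)) (d * k - 1))).transpose * hubbardCovSliceCT L M β μ 0 (klFlowFrameU L M β U μ n) (klScale klE0 (d * (k + 1))) (klScale klE0 (d * k)) * sectorSubMatrix L M β (bgmFatMultiplier L M klE0 β (nambuXiCT L μ (klFlowFrameU L M β U μ n)) (d * k - 1))) X Y‖ *
            klScaleWt L M β j {latticeLegPos (2 * (2 * M)) X, latticeLegPos (2 * (2 * M)) Y} ≤ Cb * ((M : ℝ) / β) / klScale klE0 (d * (k + 1))) ∧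
        (∀ Y, ∑ X, ‖((sectorSubMatrix L M β (bgmFatMultiplier L M klE0 β (nambuXiCT L μ (klFlowFrameU L M β U μ n)) (d * k - 1))).transpose * hubbardCovSliceCT L M β μ 0 (klFlowFrameU L M β U μ n) (klScale klE0 (d * (k + 1))) (klScale klE0 (d * k)) * sectorSubMatrix L M β (bgmFatMultiplier L M klE0 β (nambuXiCT L μ (klFlowFrameU L M β U μ n)) (d * k - 1))) X Y‖ *
            klScaleWt L M β j {latticeLegPos (2 * (2 * M)) X, latticeLegPos (2 * (2 * M)) Y} ≤ Cb * ((M : ℝ) / β) / klScale klE0 (d * (k + 1))) ∧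
        Cb * ((M : ℝ) / β) / klScale klE0 (d * (k + 1)) ≤ Cb * ((M : ℝ) / β) * (4 : ℝ) ^ d / klE0 * (4 : ℝ) ^ (d * k) ∧
        (∀ X'', ∑ X', ‖(sectorAnalysisMatrix L M β (klAnisoFamily L M β μ (klFlowFrameU L M β U μ n) klE0 (d * k)) * sectorSubMatrix L M β (bgmFatMultiplier L M klE0 β (nambuXiCT L μ (klFlowFrameU L M β U μ n)) (d * k - 1))) X'' X'‖ *
            klScaleWt L M β j {latticeLegPos (2 * (2 * M)) X'', latticeLegPos (2 * (2 * M)) X'} ≤ 81 * CJ * M / β) ∧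
        (∀ X', ∑ X'', ‖(sectorAnalysisMatrix L M β (klAnisoFamily L M β μ (klFlowFrameU L M β U μ n) klE0 (d * k)) * sectorSubMatrix L M β (bgmFatMultiplier L M klE0 β (nambuXiCT L μ (klFlowFrameU L M β U μ n)) (d * k - 1))) X'' X'‖ *
            klScaleWt L M β j {latticeLegPos (2 * (2 * M)) X'', latticeLegPos (2 * (2 * M)) X'} ≤ 162 * CJ * M / β) := by
  obtain ⟨Cκ, hCκ, hg⟩ := gram_sliceCT_bgmFat_sharp_klEng
  obtain ⟨Cb, hCb, hαp⟩ := alphaWt_towerBlock_klEng_flow_all' d R c'' hc''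
  obtain ⟨CJ, hCJ, hop⟩ := overlapWt_towerBlock_klEng_flow_all d R c'' hc''.le
  refine ⟨Cκ, Cb, CJ, hCκ, hCb, hCJ, ?_⟩
  intro G P Q c hP hR2 hc hc6 μ hμ U hU hU9 hcU β hβmin hβc L M _ _ hL3 hM3 n hn1 hnN hreg hhist hfr hosc k hk1 hdk hkN hkn j hkj
  have he : (0 : ℝ) < klE0 := by norm_num [klE0]
  have hβ : 0 < β := KLRegimeSplit.pos_of_klBetaMin_le hβmin
  have hM0 : (0 : ℝ) < M := Nat.cast_pos.2 (Nat.pos_of_ne_zero (NeZero.ne M))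
  have hU4 : U ≤ klEngU₀4 P R c := hU9.trans (klEngU₀9_le_klEngU₀4 P R c)
  have hU3g : U ≤ min (klEngU₀3 P R c) (1 / (R.Gfr 3 + 1)) :=
    le_min (hU9.trans (klEngU₀9_le_klEngU₀3 P R c)) (hU9.trans (klEngU₀9_le_inv_gfr_add_one P hR2.wf c (by norm_num)))
  have hc3 : c ≤ klEngC₃3 P R := hc6.trans (klEngC₃6_le_klEngC₃3 P R)
  set K : TrigPolyC4v := klFlowFrameU L M β U μ n with hKdef
  obtain ⟨hrow, hcol⟩ := hαp G P Q c hR2 hc hc6 μ hμ U hU hU3g hcU β hβmin hβc L M hL3 hM3 n hn1 hnN hreg hhist hosc k hk1 hdk hkN j hkj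
  obtain ⟨hrow', hcol'⟩ := hop G P Q c hR2 hc hc6 μ hμ U hU hU3g hcU β hβmin hβc L M hL3 hM3 n hn1 hnN hreg hhist hosc k (by omega) hkn j hkj
  refine ⟨?_, ?_, ?_, hrow, hcol, ?_, hrow', ?_⟩
  · have h1 : 0 < klScale klE0 (d * k) := klth_klScale_pos _
    have h2 : 0 < klScale klE0 (d * k - 1) := klth_klScale_pos _
    exact Real.sqrt_pos.2 (by positivity)
  · rw [gramF_sq_mul_pow_eq hCκ.le (by omega)]
  · have hΛpos : 0 < klScale klE0 (d * (k + 1)) := klth_klScale_pos _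
    have hΛle : klScale klE0 (d * (k + 1)) ≤ klScale klE0 (d * k) := klScale_le_klScale he.le (Nat.mul_le_mul_left d (Nat.le_succ k))
    have hΛle' : klScale klE0 (d * k) ≤ klScale klE0 (d * k - 1) := klScale_le_klScale he.le (by omega)
    obtain ⟨m, hm⟩ : ∃ m, d * k - 1 = m + 1 := ⟨d * k - 2, by omega⟩
    have hmul : d * (k + 1) = d * k + d := Nat.mul_succ d k
    have h := (hg P R c hP hR2 hc hc3 μ hμ U hU hU4 β hβmin hβc K hfr L M hL3 hM3 m (by omega)
      (klScale klE0 (d * (k + 1))) (klScale klE0 (d * k)) hΛpos hΛle (by rw [← hm]; exact hΛle')).2.1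
    rw [← hm] at h
    exact h
  · rw [alphaF_eq_bound_mul_pow]
  · have h2 : (2 : ℝ) ^ (d * k - (d * k - 1)) = 2 := by rw [show d * k - (d * k - 1) = 1 by omega, pow_one]
    intro X'
    have h := hcol' X'
    rw [h2] at h
    exact h.trans (le_of_eq (by ring))

end Summit.HubbardSuperconductivity.HubbardSuperconductivity.Theorems.EngineV8

end
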